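import Summits.Langlands.Langlands.Theses.QuarterDeficit1951
import Summits.Langlands.Langlands.Theorems.QuarterFingerprintDeficit.Negative.QuarterFingerprintDeficitFalseOfEvenIcosahedralMaassFormAt1951

/-!
# `CensusDeficit1951` (stmt-Langlands-17933) — negative lemma: the certified-census crux fails as soon as
# ONE even icosahedral λ = 1/4 Maass newform at conductor 1951 exists

Line `conjugate-pair-census` of crux stmt-Langlands-17933, lead seat prover-line-stmt-Langlands-17933-0,
2026-08-17.

`Summit.Langlands.Langlands.Theses.QuarterDeficit1951.CensusDeficit1951` (D) says: every order-5 Dirichlet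
character `χ mod 1951` carries a transcript `c : MaassHeckeTraceCensus` with `window ≥ 1/100`,
`fpTol ≥ 1/100`, `fpPrimes ⊆ {2,3,5,7,11,13}` which IS a certified census of the weight-0 cuspidal spectrum of
`(Γ₀(1951), χ)` (`CertifiedMaassHeckeTraceCensus 1951 χ c`) and whose verdict `c.certifiesDeficit` is `true`.

`EvenIcosahedralMaassFormAt1951` (H, landed with the parent crux's negative lemma, p128419) is what conjunct (B)
of the summit statement predicts for the Doud–Moore even icosahedral Artin representations of conductor 1951,
and what the Hejhal sighting `Cruxes/QuarterFingerprintDeficit/SightingHejhalR0.md` (kit j020406/j020407/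
j020748/j020749) exhibits numerically in ALL FOUR order-5 character spaces: an order-5 `χ` and a nonzero
bounded `C²` cusp form `u` on `(Γ₀(1951), χ)` (route vocabulary: automorphy `u(γz) = χ(d_γ)u(z)`, zero
constant terms at the cusps `∞` and `0`) with `λ = 1/4` EXACTLY which is a joint `T_p`-eigenfunction for
`p ≤ 13` with `μ_p² χ̄(p) ∈ Φ = {0, 1, 4, (3 ± √5)/2}` EXACTLY.

What is PROVED here (kernel-checked, no `sorry`):
* `not_censusDeficit1951_of_fingerprinted_window_form` — in the census' own vocabulary: one nonzero
  `IsMaassCuspFormOn 1951 χ u λ` with `|λ − 1/4| ≤ 1/100`, `χ` of order 5, `T_p u = μ_p u` and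
  `dist(μ_p² χ̄(p), Φ) ≤ 1/100` for `p ∈ {2,…,13}` refutes D (decoding theorem I
  `MaassHeckeTraceCensus.not_fingerprinted` applied to the transcript D provides for `χ`).
* `isMaassCuspFormOn_of_two_cusps` — the route ⟶ census DICTIONARY at level 1951 (the content of item
  stmt-Langlands-17934 `WindowFormDictionary`, with explicit binders): the route's inlined Maass predicate (two
  cusp clauses: period 1 at `∞`, period 1951 at `0 = S·∞`) implies `IsMaassCuspFormOn 1951 χ u λ`, whose extra
  content is the period-1951 cuspidality at `g·∞` for EVERY `g ∈ SL₂(ℤ)`: if `1951 ∣ c(g)` then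
  `g ∈ Γ₀(1951)` and 1-periodicity gives `∫₀¹⁹⁵¹ = 1951 • ∫₀¹ = 0`; otherwise `g = γ·S·Tᵏ` with
  `k ≡ d c⁻¹ (mod 1951)`, `γ = g T⁻ᵏ S⁻¹ ∈ Γ₀(1951)` with `d`-entry `c`, so `u(g(x+iy)) = χ(c)·u(S((x+k)+iy))`
  and `x ↦ u(S(x+iy))` is 1951-periodic (`S T¹⁹⁵¹ S⁻¹ = (1 0; −1951 1) ∈ Γ₀(1951)`, `d`-entry 1).
* `CensusDeficit1951_false_of_EvenIcosahedralMaassFormAt1951 : H → ¬ D` — the composition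
  (`maassHeckeOp_prime` turns the route's inlined `T_p` into `maassHeckeOp 1951 χ p`).
Together with the landed `evenIcosahedralMaassFormAt1951_of_langlands` (C2a, C2b proved) this records in the
kernel that D can only hold if typed reciprocity FAILS at conductor 1951, and that the kit sighting, once
certified, closes D as refuted.
-/

-- `Summit.<Summit>.<Problem>`: for the single-conjunct summit `Langlands` the duplicate is mandated.
set_option linter.dupNamespace false

namespace Summit.Langlands.Langlands.Theorems.CensusDeficit1951.Negative

open scoped MatrixGroups ComplexConjugate
open Literature.NumberTheory.Automorphic ModularGroup UpperHalfPlane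
open Summit.Langlands.Langlands.Theses.QuarterDeficit1951
open Summit.Langlands.Langlands.Theorems.QuarterFingerprintDeficit.Negative (EvenIcosahedralMaassFormAt1951)

/-! ## 1. The obstruction in census vocabulary -/

/-- **One fingerprinted window form for one order-5 character refutes `CensusDeficit1951`.** If some
order-5 `χ mod 1951` carries a nonzero weight-0 Maass cusp form `u` (`IsMaassCuspFormOn 1951 χ u λ`) with
`|λ − 1/4| ≤ 1/100` which is a `T_p`-eigenfunction for `p ∈ {2,3,5,7,11,13}` with `μ_p² χ̄(p)` within `1/100`
of `Φ`, then no transcript with `window, fpTol ≥ 1/100`, `fpPrimes ⊆ {2,…,13}` can be a certified census for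
`χ` with the deficit verdict: decoding theorem I (`MaassHeckeTraceCensus.not_fingerprinted`) would put
`μ_p² χ̄(p)` farther than `fpTol ≥ 1/100` from every point of `Φ` at some fingerprint prime. [folklore] -/
theorem not_censusDeficit1951_of_fingerprinted_window_form
    (hex : ∃ χ : DirichletCharacter ℂ 1951, orderOf χ = 5 ∧ ∃ (u : ℍ → ℂ) (lam : ℝ),
      IsMaassCuspFormOn 1951 χ u lam ∧ (∃ z, u z ≠ 0) ∧ |lam - 1 / 4| ≤ 1 / 100 ∧
      ∀ p ∈ ({2, 3, 5, 7, 11, 13} : Finset ℕ), ∃ μ φ : ℂ, φ ∈ icosahedralFingerprint ∧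
        maassHeckeOp 1951 χ p u = μ • u ∧ ‖μ ^ 2 * conj (χ (p : ZMod 1951)) - φ‖ ≤ 1 / 100) :
    ¬ CensusDeficit1951 := by
  intro hD
  obtain ⟨χ, hχ, u, lam, hu, hne, hwin, hfp⟩ := hex
  obtain ⟨c, hw, ht, hP, hcert, hv⟩ := hD χ hχ
  choose! μ φ hφ hT hdist using hfp
  have hT' : ∀ p ∈ c.fpPrimes, maassHeckeOp 1951 χ p u = μ p • u := fun p hp => hT p (hP p hp)
  have hw' : ((1 / 100 : ℚ) : ℝ) ≤ (c.window : ℝ) := Rat.cast_le.mpr hw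
  have ht' : ((1 / 100 : ℚ) : ℝ) ≤ (c.fpTol : ℝ) := Rat.cast_le.mpr ht
  push_cast at hw' ht'
  have hwin' : |lam - 1 / 4| ≤ (c.window : ℝ) := hwin.trans hw'
  obtain ⟨p, hp, hfar⟩ := MaassHeckeTraceCensus.not_fingerprinted hcert hv hu hne hwin' hT'
  have h1 := hfar (φ p) (hφ p (hP p hp))
  have h2 := hdist p (hP p hp)
  linarith

/-! ## 2. The dictionary: the route's two cusp clauses give cuspidality at every cusp `g · ∞` -/

/-- Entries of `T`: `T 1 0 = 0`. [folklore] -/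
theorem T_apply_10 : (T : SL(2, ℤ)) 1 0 = 0 := by simp [coe_T]

/-- Entries of `T`: `T 1 1 = 1`. [folklore] -/
theorem T_apply_11 : (T : SL(2, ℤ)) 1 1 = 1 := by simp [coe_T]

/-- `S Tⁿ S⁻¹ = (1 0; -n 1)`: entry `(1,0)` is `-n`. [folklore] -/
theorem S_T_zpow_S_inv_apply_10 (n : ℤ) : (S * T ^ n * S⁻¹ : SL(2, ℤ)) 1 0 = -n := by
  simp [Matrix.SpecialLinearGroup.coe_mul, Matrix.SpecialLinearGroup.coe_inv, coe_T_zpow, coe_S,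
    Matrix.adjugate_fin_two_of, Matrix.mul_apply, Fin.sum_univ_two]

/-- `S Tⁿ S⁻¹ = (1 0; -n 1)`: entry `(1,1)` is `1`. [folklore] -/
theorem S_T_zpow_S_inv_apply_11 (n : ℤ) : (S * T ^ n * S⁻¹ : SL(2, ℤ)) 1 1 = 1 := by
  simp [Matrix.SpecialLinearGroup.coe_mul, Matrix.SpecialLinearGroup.coe_inv, coe_T_zpow, coe_S,
    Matrix.adjugate_fin_two_of, Matrix.mul_apply, Fin.sum_univ_two]

/-- `g T⁻ᵏ S⁻¹ = (ak-b, a; ck-d, c)`: entry `(1,0)` is `c k - d`. [folklore] -/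
theorem mul_T_zpow_neg_S_inv_apply_10 (g : SL(2, ℤ)) (k : ℤ) :
    (g * T ^ (-k) * S⁻¹ : SL(2, ℤ)) 1 0 = g 1 0 * k - g 1 1 := by
  simp [Matrix.SpecialLinearGroup.coe_mul, Matrix.SpecialLinearGroup.coe_inv, coe_T_zpow, coe_S,
    Matrix.adjugate_fin_two_of, Matrix.mul_apply, Fin.sum_univ_two]
  ring

/-- `g T⁻ᵏ S⁻¹ = (ak-b, a; ck-d, c)`: entry `(1,1)` is `c`. [folklore] -/
theorem mul_T_zpow_neg_S_inv_apply_11 (g : SL(2, ℤ)) (k : ℤ) :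
    (g * T ^ (-k) * S⁻¹ : SL(2, ℤ)) 1 1 = g 1 0 := by
  simp [Matrix.SpecialLinearGroup.coe_mul, Matrix.SpecialLinearGroup.coe_inv, coe_T_zpow, coe_S,
    Matrix.adjugate_fin_two_of, Matrix.mul_apply, Fin.sum_univ_two]

/-- The point `x + iy`, `y > 0`, has positive imaginary part. [folklore] -/
theorem im_pos_of_xy (x y : ℝ) (hy : 0 < y) : 0 < ((x : ℂ) + y * Complex.I).im := by
  simpa using hy

/-- Real translation of `ofComplex (x + iy)` is `ofComplex ((x + t) + iy)`. [folklore] -/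
theorem vadd_ofComplex_xy (t x y : ℝ) (hy : 0 < y) :
    t +ᵥ ofComplex ((x : ℂ) + y * Complex.I) = ofComplex (((x + t : ℝ) : ℂ) + y * Complex.I) := by
  apply UpperHalfPlane.ext
  rw [coe_vadd, ofComplex_apply_of_im_pos (im_pos_of_xy x y hy),
    ofComplex_apply_of_im_pos (im_pos_of_xy (x + t) y hy), UpperHalfPlane.coe_mk, UpperHalfPlane.coe_mk]
  push_cast
  ring

/-- `Tᵏ • ofComplex (x + iy) = ofComplex ((x + k) + iy)`. [folklore] -/
theorem T_zpow_smul_ofComplex_xy (k : ℤ) (x y : ℝ) (hy : 0 < y) :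
    (T ^ k : SL(2, ℤ)) • ofComplex ((x : ℂ) + y * Complex.I) =
      ofComplex (((x + (k : ℝ) : ℝ) : ℂ) + y * Complex.I) := by
  rw [modular_T_zpow_smul, vadd_ofComplex_xy (k : ℝ) x y hy]

/-- **Horizontal 1-periodicity at the cusp `∞`.** For `u` with `u(γz) = χ(d_γ)u(z)` on `Γ₀(1951)`,
`x ↦ u(x + iy)` is 1-periodic (`T ∈ Γ₀(1951)`, `d_T = 1`). [folklore] -/
theorem periodic_cuspInf (χ : DirichletCharacter ℂ 1951) (u : ℍ → ℂ)
    (hsl : ∀ γ : SL(2, ℤ), γ ∈ CongruenceSubgroup.Gamma0 1951 →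
      ∀ z : ℍ, u (γ • z) = χ ((γ 1 1 : ℤ) : ZMod 1951) * u z)
    (y : ℝ) (hy : 0 < y) :
    Function.Periodic (fun x : ℝ => u (ofComplex ((x : ℂ) + y * Complex.I))) 1 := by
  intro x
  have hT : (T : SL(2, ℤ)) ∈ CongruenceSubgroup.Gamma0 1951 := by
    rw [CongruenceSubgroup.Gamma0_mem, T_apply_10, Int.cast_zero]
  have h := hsl T hT (ofComplex ((x : ℂ) + y * Complex.I))
  rw [T_apply_11, Int.cast_one, map_one, one_mul] at h
  simp only
  rw [← h, ← zpow_one (T : SL(2, ℤ)), T_zpow_smul_ofComplex_xy 1 x y hy]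
  norm_num

/-- **Horizontal 1951-periodicity at the cusp `0`.** For `u` with `u(γz) = χ(d_γ)u(z)` on `Γ₀(1951)`,
`x ↦ u(S(x + iy))` is 1951-periodic (`S T¹⁹⁵¹ S⁻¹ = (1 0; -1951 1) ∈ Γ₀(1951)`, `d`-entry `1`). [folklore] -/
theorem periodic_cuspZero (χ : DirichletCharacter ℂ 1951) (u : ℍ → ℂ)
    (hsl : ∀ γ : SL(2, ℤ), γ ∈ CongruenceSubgroup.Gamma0 1951 →
      ∀ z : ℍ, u (γ • z) = χ ((γ 1 1 : ℤ) : ZMod 1951) * u z)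
    (y : ℝ) (hy : 0 < y) :
    Function.Periodic (fun x : ℝ => u (S • ofComplex ((x : ℂ) + y * Complex.I))) 1951 := by
  intro x
  have hmem : (S * T ^ (1951 : ℤ) * S⁻¹ : SL(2, ℤ)) ∈ CongruenceSubgroup.Gamma0 1951 := by
    rw [CongruenceSubgroup.Gamma0_mem, S_T_zpow_S_inv_apply_10]
    push_cast
    rw [neg_eq_zero]
    exact ZMod.natCast_self 1951
  have h := hsl _ hmem (S • ofComplex ((x : ℂ) + y * Complex.I))
  rw [S_T_zpow_S_inv_apply_11, Int.cast_one, map_one, one_mul, ← mul_smul] at h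
  have hgrp : (S * T ^ (1951 : ℤ) * S⁻¹ * S : SL(2, ℤ)) = S * T ^ (1951 : ℤ) := by group
  rw [hgrp, mul_smul, T_zpow_smul_ofComplex_xy (1951 : ℤ) x y hy] at h
  simp only
  rw [← h]
  norm_num

/-- Continuity of `x ↦ u(x + iy)` for `C²` `u`. [folklore] -/
theorem continuous_cuspInf (u : ℍ → ℂ) (hC2 : IsC2 u) (y : ℝ) (hy : 0 < y) :
    Continuous (fun x : ℝ => u (ofComplex ((x : ℂ) + y * Complex.I))) := by
  have hc : ContinuousOn (u ∘ ofComplex) {z : ℂ | 0 < z.im} := hC2.continuousOn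
  have hf : Continuous (fun x : ℝ => (x : ℂ) + y * Complex.I) := by fun_prop
  exact hc.comp_continuous hf (fun x => im_pos_of_xy x y hy)

/-- **The dictionary (content of `WindowFormDictionary`, stmt-Langlands-17934, at level 1951).** The route's
inlined weight-0 Maass cusp form predicate for `(Γ₀(1951), χ)` — `C²`, `Δu + λu = 0`, `u(γz) = χ(d_γ)u(z)`,
vanishing period-1 mean at `∞` and period-1951 mean at `0` (after `S`), bounded — implies the census'
`IsMaassCuspFormOn 1951 χ u λ`, i.e. additionally the vanishing of the period-1951 mean at `g · ∞` for EVERY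
`g ∈ SL₂(ℤ)`: if `1951 ∣ c(g)` then `g ∈ Γ₀(1951)` and the 1-periodic `x ↦ u(x+iy)` has
`∫₀¹⁹⁵¹ = 1951 • ∫₀¹ = 0`; otherwise `g = γ S Tᵏ` with `k ≡ d c⁻¹ (mod 1951)`, `γ = g T⁻ᵏ S⁻¹ ∈ Γ₀(1951)`
of `d`-entry `c`, so `u(g(x+iy)) = χ(c) u(S((x+k)+iy))`, and the 1951-periodic `x ↦ u(S(x+iy))` has the same
integral over `[k, k+1951]` as over `[0, 1951]`. [cite: Iwaniec2002, §2.2–§3.1] -/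
theorem isMaassCuspFormOn_of_two_cusps (χ : DirichletCharacter ℂ 1951) (u : ℍ → ℂ) (lam : ℝ)
    (hC2 : IsC2 u) (heig : ∀ z, hypLaplacian u z + (lam : ℂ) * u z = 0)
    (hsl : ∀ γ : SL(2, ℤ), γ ∈ CongruenceSubgroup.Gamma0 1951 →
      ∀ z : ℍ, u (γ • z) = χ ((γ 1 1 : ℤ) : ZMod 1951) * u z)
    (hinf : ∀ y : ℝ, 0 < y → ∫ x in (0 : ℝ)..1, u (ofComplex (x + y * Complex.I)) = 0)
    (hzero : ∀ y : ℝ, 0 < y → ∫ x in (0 : ℝ)..1951, u (S • ofComplex (x + y * Complex.I)) = 0)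
    (hbd : ∃ C : ℝ, ∀ z, ‖u z‖ ≤ C) : IsMaassCuspFormOn 1951 χ u lam := by
  refine ⟨hC2, heig, hsl, fun g y hy => ?_, hbd⟩
  haveI : Fact (Nat.Prime 1951) := ⟨by norm_num⟩
  by_cases hc : ((g 1 0 : ℤ) : ZMod 1951) = 0
  · -- `g ∈ Γ₀(1951)`: the integrand is `χ(d) u(x+iy)`, 1-periodic, with zero mean over a period
    have hg : g ∈ CongruenceSubgroup.Gamma0 1951 := CongruenceSubgroup.Gamma0_mem.mpr hc
    have hF := periodic_cuspInf χ u hsl y hy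
    have hint : ∀ t₁ t₂ : ℝ, IntervalIntegrable (fun x : ℝ => u (ofComplex ((x : ℂ) + y * Complex.I)))
        MeasureTheory.volume t₁ t₂ := fun t₁ t₂ => (continuous_cuspInf u hC2 y hy).intervalIntegrable _ _
    have hper := hF.intervalIntegral_add_zsmul_eq (1951 : ℤ) 0 hint
    simp only [zero_add, zsmul_eq_mul, Int.cast_ofNat, mul_one] at hper
    simp_rw [hsl g hg]
    rw [intervalIntegral.integral_const_mul]
    push_cast
    rw [hper, hinf y hy, mul_zero, mul_zero]
  · -- `g = γ S Tᵏ` with `γ ∈ Γ₀(1951)` of `d`-entry `c(g)`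
    set cZ : ZMod 1951 := ((g 1 0 : ℤ) : ZMod 1951) with hcZ
    set dZ : ZMod 1951 := ((g 1 1 : ℤ) : ZMod 1951) with hdZ
    set k : ℤ := ((dZ * cZ⁻¹ : ZMod 1951).val : ℤ) with hkdef
    have hk : ((k : ℤ) : ZMod 1951) = dZ * cZ⁻¹ := by
      simp [hkdef, ZMod.natCast_val, ZMod.cast_id]
    set γ : SL(2, ℤ) := g * T ^ (-k) * S⁻¹ with hγdef
    have hγ : γ ∈ CongruenceSubgroup.Gamma0 1951 := by
      rw [CongruenceSubgroup.Gamma0_mem, hγdef, mul_T_zpow_neg_S_inv_apply_10]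
      push_cast
      rw [← hcZ, ← hdZ, hk, mul_comm dZ, ← mul_assoc, mul_inv_cancel₀ hc, one_mul, sub_self]
    have hγ11 : ((γ 1 1 : ℤ) : ZMod 1951) = cZ := by
      rw [hγdef, mul_T_zpow_neg_S_inv_apply_11]
    have hgeq : g = γ * S * T ^ k := by rw [hγdef]; group
    have hG := periodic_cuspZero χ u hsl y hy
    have hpt : ∀ x : ℝ, u (g • ofComplex ((x : ℂ) + y * Complex.I)) =
        χ cZ * u (S • ofComplex ((((x + (k : ℝ)) : ℝ) : ℂ) + y * Complex.I)) := fun x => by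
      rw [hgeq, mul_smul, mul_smul, hsl γ hγ, hγ11, T_zpow_smul_ofComplex_xy k x y hy]
    simp_rw [hpt]
    rw [intervalIntegral.integral_const_mul,
      intervalIntegral.integral_comp_add_right (fun x : ℝ => u (S • ofComplex ((x : ℂ) + y * Complex.I))) (k : ℝ),
      zero_add]
    have hshift := hG.intervalIntegral_add_eq (k : ℝ) 0
    rw [zero_add, add_comm] at hshift
    push_cast
    rw [hshift, hzero y hy, mul_zero]

/-! ## 3. `CensusDeficit1951` is false modulo `EvenIcosahedralMaassFormAt1951` -/

/-- The six fingerprint primes are prime. [folklore] -/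
theorem prime_of_mem_fpPrimes {p : ℕ} (hp : p ∈ ({2, 3, 5, 7, 11, 13} : Finset ℕ)) : p.Prime := by
  simp only [Finset.mem_insert, Finset.mem_singleton] at hp
  rcases hp with rfl | rfl | rfl | rfl | rfl | rfl <;> norm_num

/-- **`CensusDeficit1951` is false modulo H.** If one even icosahedral `λ = 1/4` Maass form at `(1951, χ)`,
`χ` of order 5, exists with the exact projective fingerprint at `p ≤ 13` (`EvenIcosahedralMaassFormAt1951`,
the construction hypothesis of the parent crux's negative lemma), then the certified-census crux
`CensusDeficit1951` fails: the dictionary makes the form an `IsMaassCuspFormOn 1951 χ u (1/4)`,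
`maassHeckeOp_prime` identifies the route's inlined `T_p` with `maassHeckeOp 1951 χ p`, `λ = 1/4` is in the
window and exact membership `μ_p² χ̄(p) ∈ Φ` is within `1/100`; now apply
`not_censusDeficit1951_of_fingerprinted_window_form`. -/
theorem CensusDeficit1951_false_of_EvenIcosahedralMaassFormAt1951
    (H : EvenIcosahedralMaassFormAt1951) : ¬ CensusDeficit1951 := by
  obtain ⟨χ, hχ, u, hform, hne, hfp⟩ := H
  obtain ⟨hC2, heig, hsl, hinf, hzero, hbd⟩ := hform
  refine not_censusDeficit1951_of_fingerprinted_window_form ⟨χ, hχ, u, 1 / 4,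
    isMaassCuspFormOn_of_two_cusps χ u (1 / 4) hC2 heig hsl hinf hzero hbd, hne, by norm_num,
    fun p hp => ?_⟩
  obtain ⟨μ, φ, hφ, hT, hμ⟩ := hfp p hp
  refine ⟨μ, φ, hφ, ?_, ?_⟩
  · funext z
    rw [maassHeckeOp_prime 1951 χ (prime_of_mem_fpPrimes hp) u z, Pi.smul_apply, smul_eq_mul]
    exact hT z
  · rw [hμ, sub_self, norm_zero]
    norm_num

end Summit.Langlands.Langlands.Theorems.CensusDeficit1951.Negative
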